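import Summits.HubbardSuperconductivity.HubbardSuperconductivity.Theorems.AnisotropyChordTransferFibre3TwoHoleBSPerron
import Mathlib.NumberTheory.Harmonic.Bounds

/-!
# Route `AnisotropyChord` / H0 rotor rung: the LIFTED MARGIN of the two-hole skeleton and the HONEST near-pair HOLE₂(.75) tail for all large `L`

Eleventh file of the `TwoHoleBS` (PROP BS) chain (memo ROTOR-THEORY-21 §317(b) «closed-form margin, 2×2 compression»,
§317(d) «tail inequality»).  `…Fibre3TwoHoleBSPerron` showed that `P∞ = twoHolePinf (skelA d)` annihilates `1_B`, so the
`L`-free margin hypothesis of `dualCert_threeQuarter_near_inf` is unsatisfiable.  The margin of the finite-capacity map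
`P(Λ) = P∞ + x_B x_Bᵀ/(s(Λs − 1))` (`twoHoleP_eq_inf`) lives in the lifted null direction and is `≈ 1/(8Λ)`; this file makes
that quantitative and replaces the vacuous `_near_eventually` by a theorem with SATISFIABLE `L`-free hypotheses:
* `scalar_margin`, ★★ `lift_margin` (exact-null-vector 2×2 compression on the eight boundary slots: `P` symmetric, `P1 = 0`,
  `P ≥ g > 0` on zero-sum vectors ⇒ `P + ρ·x xᵀ ⪰ ρX²g/(8(g + ρ‖x‖²))`, `X = Σx`);
* `twoHolePinf_isSymm`, `xBsq` (`‖x_B‖²`), `liftMargin` (`m(Λ) = ρs²g/(8(g + ρ‖x_B‖²))`, `ρ = 1/(s(Λs−1))`; memo's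
  `g s/(8(Λs−1)(g + ‖x_B‖²/(s(Λs−1))))`), ★★ `twoHoleP_quad_ge_liftMargin` (`twoHoleP (skelA d) Λ ⪰ m(Λ)` for `Λs > 1`),
  `liftMargin_ge` (`m(Λ) ≥ g/(8Λ(g + ‖x_B‖²/s))` for `Λs ≥ 2` — the `κ = 1/|B|` law with explicit loss);
* `alphaCol`, `Kinf` (`K = Σ_q α_q²`, `α_q = Σ_p|E∞_{pq}| + |x_q|Σ|x|/s`), ★ `Ninf_sq_le` (`Ninf(w)² ≤ K‖w‖²`);
* ★★★ `dualCert_threeQuarter_near_of_gap` (EXPLICIT THRESHOLD FORM, `8 ≤ L`, `|d|₁ ≥ 2`): invertible skeleton, `s > 0`, gap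
  `g > 0` of `P∞` on zero-sum boundary vectors, `Λup ≥ 4H_{⌊L/2⌋}`, `Λup·s ≥ 2`, `ε(L,d)·K ≤ m(Λup)` ⇒ `DualCert L (¾ε₁) z (z+d)`;
* the all-large-`L` corollary `dualCert_threeQuarter_near_eventually_of_gap` is in the next file `…Fibre3TwoHoleBSEventually`.
What remains per offset `d` (disjoint crosses, `|d|₁ ≥ 3`): the three facts as NUMERICAL certificates on the explicit ℤ² matrix
(entries in `ℚ + ℚ/π` on the window `|r|∞ ≤ 5`, p1 `…Fibre3ZSquareWindow`) — invertibility and `s > 0` follow from strict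
conditional negative definiteness of `A`, the gap from a zero-sum charge map (variational, inverse-free); both are rational
`LDLᵀ` checks.  With the crude constants here (`C₀ ≈ 222`, capacity `4H`) `L₀` is astronomically large; the sharp rate
(`abs_aKer_sub_aZ2_le_sharp`) and p1 g25's sharp capacity (`two_Gres_lamH_zero_le_sharp`) slot into the explicit form.
Prover seat `hubbard-h0-rotor-p2` g3; helper for stmt-HubbardSuperconductivity-19089 (`--supports`, helper class).
WHAT THIS IS NOT: nothing here proves superconductivity in the Hubbard model; the rotor TARGET as originally worded stays
FALSE (g15 verdict).  Near pairs with disjoint crosses only; the overlapping-cross pairs `(1,0),(1,1),(2,0)`, far pairs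
(`|d| → ∞` with `L`) and `9 ≤ L < L₀` beyond p3's `32` remain.  Mathlib + tree imports only; no sorry, no axioms.
-/

set_option linter.dupNamespace false

noncomputable section

open scoped BigOperators
open Complex Finset

namespace Summit.HubbardSuperconductivity.HubbardSuperconductivity.Theorems.AnisotropyChord.Transfer.Fibre3

namespace TwoHoleBS

/-! ## The 2×2 lift lemma: an exact null vector plus a gap, lifted by a rank-one term -/

/-- scalar core of the lift lemma (Young's inequality): with `T = ‖w‖²`, `q = wᵀPw ≥ gT`, `b = x·w`, `b² ≤ (xx − X²/n)T`,
`m = ρX²g/(n(g + ρ·xx))`: `m(S²/n + T) ≤ q + ρ(SX/n + b)²`. [folklore] -/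
theorem scalar_margin (g ρ xx X n S T b q : ℝ) (hn : 0 < n) (hg : 0 < g) (hρ : 0 < ρ) (hxx : 0 < xx)
    (hT : 0 ≤ T) (hq : g * T ≤ q) (hb : b ^ 2 ≤ (xx - X ^ 2 / n) * T) :
    ρ * X ^ 2 * g / (n * (g + ρ * xx)) * (S ^ 2 / n + T) ≤ q + ρ * (S * X / n + b) ^ 2 := by
  have hD : 0 < n * (g + ρ * xx) := by positivity
  rw [div_mul_eq_mul_div, div_le_iff₀ hD]
  set c := S * X / n + b with hc
  have hSX : S * X / n = c - b := by rw [hc]; ring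
  -- Young: `−2ρg·b·c·xx ≤ g²b² + ρ²xx²c²`
  have hyoung : -(2 * ρ * g * b * c) * xx ≤ g ^ 2 * b ^ 2 + ρ ^ 2 * xx ^ 2 * c ^ 2 := by
    nlinarith [sq_nonneg (g * b + ρ * xx * c)]
  have hmain : ρ * X ^ 2 * g * (S ^ 2 / n + T) * xx ≤ (q + ρ * c ^ 2) * (n * (g + ρ * xx)) * xx := by
    have e1 : ρ * X ^ 2 * g * (S ^ 2 / n) = ρ * g * n * (S * X / n) ^ 2 := by
      field_simp
    have e2 : ρ * X ^ 2 * g * (S ^ 2 / n + T) = ρ * g * n * (c - b) ^ 2 + ρ * g * X ^ 2 * T := by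
      rw [mul_add, e1, hSX]; ring
    rw [e2]
    have hqT : g * T * (n * (g + ρ * xx)) * xx ≤ q * (n * (g + ρ * xx)) * xx :=
      mul_le_mul_of_nonneg_right (mul_le_mul_of_nonneg_right hq hD.le) hxx.le
    have hbT : ρ * g * b ^ 2 * n * xx + ρ * g * X ^ 2 * T * xx ≤ ρ * g * xx * T * n * xx := by
      have h1 : b ^ 2 * n ≤ (xx - X ^ 2 / n) * T * n := mul_le_mul_of_nonneg_right hb hn.le
      have h2 : (xx - X ^ 2 / n) * T * n = xx * T * n - X ^ 2 * T := by field_simp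
      rw [h2] at h1
      have h3 : 0 ≤ ρ * g * xx := by positivity
      nlinarith
    have hb' : b ^ 2 ≤ xx * T := by
      have : 0 ≤ X ^ 2 / n * T := by positivity
      nlinarith
    have H1 : -(2 * ρ * g * b * c) * xx * n ≤ (g ^ 2 * b ^ 2 + ρ ^ 2 * xx ^ 2 * c ^ 2) * n :=
      mul_le_mul_of_nonneg_right hyoung hn.le
    have H2 : n * g ^ 2 * b ^ 2 ≤ n * g ^ 2 * (xx * T) := mul_le_mul_of_nonneg_left hb' (by positivity)
    have expand : (ρ * g * n * (c - b) ^ 2 + ρ * g * X ^ 2 * T) * xx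
        = ρ * g * n * xx * c ^ 2 + (-(2 * ρ * g * b * c) * xx * n) + (ρ * g * b ^ 2 * n * xx + ρ * g * X ^ 2 * T * xx) := by
      ring
    have expand2 : (q + ρ * c ^ 2) * (n * (g + ρ * xx)) * xx
        = q * (n * (g + ρ * xx)) * xx + ρ * g * n * xx * c ^ 2 + ρ ^ 2 * xx ^ 2 * c ^ 2 * n := by ring
    rw [expand, expand2]
    have e3 : g * T * (n * (g + ρ * xx)) * xx = n * g ^ 2 * (xx * T) + ρ * g * xx * T * n * xx := by ring
    rw [e3] at hqT
    nlinarith [H1, H2, hbT, hqT]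
  exact le_of_mul_le_mul_right hmain hxx

/-- ★★ **LIFT LEMMA** (the 2×2 compression of memo 21 §317(b), exact-null-vector form) on the eight boundary slots: if the
symmetric `P` annihilates `1` and is `≥ g > 0` on zero-sum vectors, then for any `x` (`X = Σx`) and `ρ > 0`,
`P + ρ·x xᵀ ⪰ m·1` with `m = ρX²g/(8(g + ρ‖x‖²))`. [folklore] -/
theorem lift_margin (P : Matrix (Fin 4 ⊕ Fin 4) (Fin 4 ⊕ Fin 4) ℝ) (hP : P.IsSymm)
    (h0 : P.mulVec (fun _ => (1 : ℝ)) = 0) (g : ℝ) (hg : 0 < g)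
    (hgap : ∀ w : Fin 4 ⊕ Fin 4 → ℝ, ∑ i, w i = 0 → g * dotProduct w w ≤ dotProduct w (P.mulVec w))
    (x : Fin 4 ⊕ Fin 4 → ℝ) (hx : 0 < dotProduct x x) (ρ : ℝ) (hρ : 0 < ρ) (v : Fin 4 ⊕ Fin 4 → ℝ) :
    ρ * (∑ i, x i) ^ 2 * g / (8 * (g + ρ * dotProduct x x)) * dotProduct v v
      ≤ dotProduct v (P.mulVec v) + ρ * (dotProduct x v) ^ 2 := by
  set S := ∑ i, v i with hS
  set X := ∑ i, x i with hX
  set w : Fin 4 ⊕ Fin 4 → ℝ := fun i => v i - S / 8 with hw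
  have hcard : (Finset.univ : Finset (Fin 4 ⊕ Fin 4)).card = 8 := by simp
  have hsumw : ∑ i, w i = 0 := by
    simp only [hw, Finset.sum_sub_distrib, Finset.sum_const, hcard, nsmul_eq_mul, ← hS]
    ring
  have hv : v = w + fun _ => S / 8 := by funext i; simp [hw]
  have hcdot : ∀ u : Fin 4 ⊕ Fin 4 → ℝ, dotProduct (fun _ => S / 8) u = (S / 8) * ∑ i, u i := by
    intro u; simp only [dotProduct, Finset.mul_sum]
  -- (a) the quadratic form of `P` only sees `w`
  have h1w : dotProduct (fun _ => (1 : ℝ)) (P.mulVec w) = 0 := by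
    rw [Matrix.dotProduct_mulVec, ← Matrix.mulVec_transpose, hP.eq, h0, zero_dotProduct]
  have hPv : P.mulVec v = P.mulVec w := by
    rw [hv, Matrix.mulVec_add]
    have : P.mulVec (fun _ => S / 8) = (S / 8) • P.mulVec (fun _ => (1 : ℝ)) := by
      rw [← Matrix.mulVec_smul]; congr 1; funext i; simp
    rw [this, h0, smul_zero, add_zero]
  have hquad : dotProduct v (P.mulVec v) = dotProduct w (P.mulVec w) := by
    rw [hPv, hv, add_dotProduct, hcdot]
    have : ∑ i, P.mulVec w i = dotProduct (fun _ => (1 : ℝ)) (P.mulVec w) := by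
      simp only [dotProduct, one_mul]
    rw [this, h1w, mul_zero, add_zero]
  -- (b) `‖v‖² = ‖w‖² + S²/8`
  have hnorm : dotProduct v v = dotProduct w w + S ^ 2 / 8 := by
    rw [hv, add_dotProduct, dotProduct_add, dotProduct_add, hcdot, hcdot, dotProduct_comm w (fun _ => S / 8), hcdot,
      hsumw]
    simp only [Finset.sum_const, hcard, nsmul_eq_mul]
    ring
  -- (c) `x·v = (S/8)X + x·w`
  have hxv : dotProduct x v = S * X / 8 + dotProduct x w := by
    rw [hv, dotProduct_add, dotProduct_comm x (fun _ => S / 8), hcdot, ← hX]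
    ring
  -- (d) Cauchy–Schwarz against `x⊥ = x − (X/8)·1`
  have hxw : dotProduct x w = ∑ i, (x i - X / 8) * w i := by
    simp only [dotProduct, sub_mul, Finset.sum_sub_distrib, ← Finset.mul_sum, hsumw, mul_zero, sub_zero]
  have hcs : (dotProduct x w) ^ 2 ≤ (dotProduct x x - X ^ 2 / 8) * dotProduct w w := by
    rw [hxw]
    refine (Finset.sum_mul_sq_le_sq_mul_sq Finset.univ (fun i => x i - X / 8) w).trans (le_of_eq ?_)
    have e : ∑ i, (x i - X / 8) ^ 2 = dotProduct x x - X ^ 2 / 8 := by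
      have : ∀ i, (x i - X / 8) ^ 2 = x i * x i - (X / 4) * x i + X ^ 2 / 64 := fun i => by ring
      simp only [this, Finset.sum_add_distrib, Finset.sum_sub_distrib, ← Finset.mul_sum, ← hX, Finset.sum_const, hcard,
        nsmul_eq_mul, dotProduct]
      ring
    rw [e]
    simp only [dotProduct, pow_two]
  -- (e) scalar lemma
  have hT : 0 ≤ dotProduct w w := by
    simp only [dotProduct]; exact Finset.sum_nonneg fun i _ => mul_self_nonneg _
  have key := scalar_margin g ρ (dotProduct x x) X 8 S (dotProduct w w) (dotProduct x w) (dotProduct w (P.mulVec w))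
    (by norm_num) hg hρ hx hT (hgap w hsumw) hcs
  rw [hnorm, hquad, hxv, add_comm (dotProduct w w)]
  exact key

/-! ## The lifted margin of the two-hole skeleton at finite capacity -/

/-- `P∞` of a symmetric matrix is symmetric. [folklore] -/
theorem twoHolePinf_isSymm (d : ℤ × ℤ) : (twoHolePinf (skelA d)).IsSymm := by
  have h := skelA_inv_isSymm d
  ext i j
  simp only [twoHolePinf, Matrix.transpose_apply, Matrix.of_apply]
  rw [h.apply (TwoChannel.emb j) (TwoChannel.emb i), mul_comm (TwoChannel.xvec2 _ (TwoChannel.emb j))]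
  by_cases hij : i = j
  · subst hij; rfl
  · rw [if_neg hij, if_neg (Ne.symm hij)]

/-- the boundary `ℓ²` mass of the harmonic-measure vector, `‖x_B‖² = Σ_i x_{emb i}²`. [folklore] -/
def xBsq (A : Matrix (Fin 5 ⊕ Fin 5) (Fin 5 ⊕ Fin 5) ℝ) : ℝ :=
  ∑ i : Fin 4 ⊕ Fin 4, TwoChannel.xvec2 A (TwoChannel.emb i) ^ 2

/-- the lifted margin `m(Λ) = ρs²g/(8(g + ρ‖x_B‖²))`, `ρ = 1/(s(Λs − 1))` (memo §317(b): `= g s/(8(Λs−1)(g + ‖x_B‖²/(s(Λs−1))))`,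
`≈ 1/(8Λ)` for large `Λ` — the `κ = 1/|B|` law). [folklore] -/
def liftMargin (g s xx Λ : ℝ) : ℝ :=
  (1 / (s * (Λ * s - 1))) * s ^ 2 * g / (8 * (g + (1 / (s * (Λ * s - 1))) * xx))

/-- ★★ **THE LIFTED MARGIN:** for `|d|₁ ≥ 2`, invertible skeleton with `s > 0`, a gap `g > 0` of `P∞` on zero-sum boundary
vectors, and a capacity `Λ` with `Λs > 1`: `twoHoleP (skelA d) Λ ⪰ m(Λ)·1`. [folklore] -/
theorem twoHoleP_quad_ge_liftMargin (d : ℤ × ℤ) (hd : 2 ≤ |d.1| + |d.2|) (hA : IsUnit (skelA d).det)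
    (hs : 0 < TwoChannel.svec2 (skelA d)) (g : ℝ) (hg : 0 < g)
    (hgap : ∀ w : Fin 4 ⊕ Fin 4 → ℝ, ∑ i, w i = 0 →
      g * dotProduct w w ≤ dotProduct w ((twoHolePinf (skelA d)).mulVec w))
    (Λ : ℝ) (hΛ : 1 < Λ * TwoChannel.svec2 (skelA d)) (v : Fin 4 ⊕ Fin 4 → ℝ) :
    liftMargin g (TwoChannel.svec2 (skelA d)) (xBsq (skelA d)) Λ * dotProduct v v
      ≤ dotProduct v ((TwoChannel.twoHoleP (skelA d) Λ).mulVec v) := by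
  set s := TwoChannel.svec2 (skelA d) with hsdef
  set xB : Fin 4 ⊕ Fin 4 → ℝ := fun i => TwoChannel.xvec2 (skelA d) (TwoChannel.emb i) with hxB
  have hρ : 0 < 1 / (s * (Λ * s - 1)) := by
    have : 0 < Λ * s - 1 := by linarith
    positivity
  have hX : ∑ i, xB i = s := xvec2_emb_sum d hd hA
  have hxx : dotProduct xB xB = xBsq (skelA d) := by simp only [dotProduct, xBsq, hxB, pow_two]
  have hxpos : 0 < dotProduct xB xB := by
    -- `‖x_B‖² ≥ (Σx_B)²/8 = s²/8 > 0`
    have hcs := Finset.sum_mul_sq_le_sq_mul_sq Finset.univ (fun _ : Fin 4 ⊕ Fin 4 => (1 : ℝ)) xB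
    simp only [one_mul, one_pow, Finset.sum_const, Finset.card_univ, Fintype.card_sum, Fintype.card_fin,
      nsmul_eq_mul] at hcs
    rw [hX] at hcs
    have : 0 < s ^ 2 := by positivity
    simp only [dotProduct, ← pow_two]
    nlinarith
  have key := lift_margin (twoHolePinf (skelA d)) (twoHolePinf_isSymm d) (twoHolePinf_mulVec_one d hd hA hs.ne')
    g hg hgap xB hxpos (1 / (s * (Λ * s - 1))) hρ v
  rw [hX, hxx] at key
  rw [twoHoleP_quad_eq_inf (skelA d) Λ hs.ne' (by linarith) v]
  have hdot : (∑ i, TwoChannel.xvec2 (skelA d) (TwoChannel.emb i) * v i) = dotProduct xB v := by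
    simp only [dotProduct, hxB]
  rw [hdot, ← hsdef, div_eq_mul_one_div ((dotProduct xB v) ^ 2), mul_comm ((dotProduct xB v) ^ 2)]
  exact key

/-- the margin degrades only like `1/Λ`: for `Λs ≥ 2`, `m(Λ) ≥ g/(8Λ(g + ‖x_B‖²/s))`. [folklore] -/
theorem liftMargin_ge (g s xx Λ : ℝ) (hg : 0 < g) (hs : 0 < s) (hxx : 0 ≤ xx) (hΛ : 2 ≤ Λ * s) :
    g / (8 * Λ * (g + xx / s)) ≤ liftMargin g s xx Λ := by
  unfold liftMargin
  have h1 : 1 ≤ Λ * s - 1 := by linarith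
  have hΛpos : 0 < Λ := (mul_pos_iff_of_pos_right hs).mp (by linarith)
  have hρ : 0 < 1 / (s * (Λ * s - 1)) := by positivity
  -- `ρ ≥ 1/(Λ s²)` and `ρ·xx ≤ xx/s`
  have hρlow : 1 / (Λ * s ^ 2) ≤ 1 / (s * (Λ * s - 1)) := by
    rw [div_le_div_iff₀ (by positivity) (by positivity)]
    nlinarith
  have hρxx : 1 / (s * (Λ * s - 1)) * xx ≤ xx / s := by
    rw [div_mul_eq_mul_div, one_mul, div_le_div_iff₀ (by positivity) hs]
    have : s ≤ s * (Λ * s - 1) := by nlinarith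
    exact mul_le_mul_of_nonneg_left this hxx
  have hden : 0 < 8 * (g + 1 / (s * (Λ * s - 1)) * xx) := by positivity
  have hden' : 0 < 8 * Λ * (g + xx / s) := by positivity
  rw [div_le_div_iff₀ hden' hden]
  have e : 1 / (s * (Λ * s - 1)) * s ^ 2 * g * (8 * Λ * (g + xx / s))
      = (1 / (s * (Λ * s - 1)) * (Λ * s ^ 2)) * (g * (8 * (g + xx / s))) := by ring
  rw [e]
  have h2 : 1 ≤ 1 / (s * (Λ * s - 1)) * (Λ * s ^ 2) := by
    have := mul_le_mul_of_nonneg_right hρlow (show 0 ≤ Λ * s ^ 2 by positivity)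
    rwa [one_div_mul_cancel (by positivity)] at this
  have h3 : g * (8 * (g + 1 / (s * (Λ * s - 1)) * xx)) ≤ g * (8 * (g + xx / s)) := by
    have := hρxx
    nlinarith
  have h4 : 0 ≤ g * (8 * (g + xx / s)) := by positivity
  nlinarith

/-! ## An explicit `L`-free constant `K` with `Ninf(w)² ≤ K‖w‖²` -/

/-- column weights of the charge-norm majorant: `α_q = Σ_p|E∞_{pq}| + |x_q|(Σ_p|x_p|)/s`. [folklore] -/
def alphaCol (A : Matrix (Fin 5 ⊕ Fin 5) (Fin 5 ⊕ Fin 5) ℝ) (q : Fin 5 ⊕ Fin 5) : ℝ :=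
  (∑ p, |smInvInf A p q|) + |TwoChannel.xvec2 A q| * (∑ p, |TwoChannel.xvec2 A p|) / TwoChannel.svec2 A

/-- ★ the `L`-free constant `K = Σ_q α_q²`. [folklore] -/
def Kinf (A : Matrix (Fin 5 ⊕ Fin 5) (Fin 5 ⊕ Fin 5) ℝ) : ℝ := ∑ q, alphaCol A q ^ 2

/-- ★ `Ninf(w)² ≤ K·‖w‖²` (for `s > 0`; triangle inequality + Cauchy–Schwarz; `Σ_q ŵ_q² = ‖w‖²`). [folklore] -/
theorem Ninf_sq_le (A : Matrix (Fin 5 ⊕ Fin 5) (Fin 5 ⊕ Fin 5) ℝ) (hs : 0 < TwoChannel.svec2 A)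
    (w : Fin 4 ⊕ Fin 4 → ℝ) : Ninf A w ^ 2 ≤ Kinf A * dotProduct w w := by
  have hN : Ninf A w ≤ ∑ q, alphaCol A q * |pad w q| := by
    set c := (∑ p, |TwoChannel.xvec2 A p|) / TwoChannel.svec2 A with hc
    have hcnn : 0 ≤ c := by positivity
    have h1 : ∑ p, |(smInvInf A).mulVec (pad w) p| ≤ ∑ q, (∑ p, |smInvInf A p q|) * |pad w q| := by
      have step : ∑ p, |(smInvInf A).mulVec (pad w) p| ≤ ∑ p, ∑ q, |smInvInf A p q| * |pad w q| := by
        refine Finset.sum_le_sum fun p _ => ?_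
        have : (smInvInf A).mulVec (pad w) p = ∑ q, smInvInf A p q * pad w q := rfl
        rw [this]
        refine (Finset.abs_sum_le_sum_abs _ _).trans (le_of_eq ?_)
        exact Finset.sum_congr rfl fun q _ => abs_mul _ _
      refine step.trans (le_of_eq ?_)
      rw [Finset.sum_comm]
      refine Finset.sum_congr rfl fun q _ => ?_
      rw [Finset.sum_mul]
    have h2 : |∑ q, TwoChannel.xvec2 A q * pad w q| * (∑ p, |TwoChannel.xvec2 A p|) / TwoChannel.svec2 A
        ≤ ∑ q, (|TwoChannel.xvec2 A q| * c) * |pad w q| := by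
      have a : |∑ q, TwoChannel.xvec2 A q * pad w q| ≤ ∑ q, |TwoChannel.xvec2 A q| * |pad w q| := by
        refine (Finset.abs_sum_le_sum_abs _ _).trans (le_of_eq ?_)
        exact Finset.sum_congr rfl fun q _ => abs_mul _ _
      have b : |∑ q, TwoChannel.xvec2 A q * pad w q| * (∑ p, |TwoChannel.xvec2 A p|) / TwoChannel.svec2 A
          = |∑ q, TwoChannel.xvec2 A q * pad w q| * c := by rw [hc]; ring
      rw [b]
      calc |∑ q, TwoChannel.xvec2 A q * pad w q| * c ≤ (∑ q, |TwoChannel.xvec2 A q| * |pad w q|) * c :=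
            mul_le_mul_of_nonneg_right a hcnn
        _ = ∑ q, (|TwoChannel.xvec2 A q| * c) * |pad w q| := by
            rw [Finset.sum_mul]
            exact Finset.sum_congr rfl fun q _ => by ring
    have h3 : ∀ q, alphaCol A q = (∑ p, |smInvInf A p q|) + |TwoChannel.xvec2 A q| * c := by
      intro q; rw [alphaCol, hc]; ring
    calc Ninf A w = (∑ p, |(smInvInf A).mulVec (pad w) p|)
          + |∑ q, TwoChannel.xvec2 A q * pad w q| * (∑ p, |TwoChannel.xvec2 A p|) / TwoChannel.svec2 A := rfl
      _ ≤ (∑ q, (∑ p, |smInvInf A p q|) * |pad w q|) + ∑ q, (|TwoChannel.xvec2 A q| * c) * |pad w q| :=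
          add_le_add h1 h2
      _ = ∑ q, alphaCol A q * |pad w q| := by
          rw [← Finset.sum_add_distrib]
          exact Finset.sum_congr rfl fun q _ => by rw [h3]; ring
  have hN0 : 0 ≤ Ninf A w := by
    unfold Ninf
    positivity
  have hcs := Finset.sum_mul_sq_le_sq_mul_sq Finset.univ (fun q => alphaCol A q) (fun q => |pad w q|)
  have hsq : ∑ q, |pad w q| ^ 2 = dotProduct w w := by
    simp only [sq_abs]
    rw [sum_eq_sum_emb_real (F := fun q => pad w q ^ 2) (by simp [(pad_centre w).1]) (by simp [(pad_centre w).2])]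
    simp only [pad_emb, dotProduct, pow_two]
  calc Ninf A w ^ 2 ≤ (∑ q, alphaCol A q * |pad w q|) ^ 2 := pow_le_pow_left₀ hN0 hN 2
    _ ≤ (∑ q, alphaCol A q ^ 2) * ∑ q, |pad w q| ^ 2 := hcs
    _ = Kinf A * dotProduct w w := by rw [hsq]; rfl

/-! ## ★★★ The honest near-pair tail: explicit threshold form and the all-large-`L` corollary -/

variable (L : ℕ) [NeZero L]

/-- ★★★ **NEAR-PAIR HOLE₂(.75) CERTIFICATE FROM SATISFIABLE `L`-FREE SKELETON FACTS** (pair `(z, z + d)`, `|d|₁ ≥ 2`, `8 ≤ L`):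
if the explicit ℤ² skeleton `skelA d` is invertible with `s > 0` and `P∞ ≥ g > 0` on ZERO-SUM boundary vectors (the gap
beside the exact null vector `1_B`), then for any capacity parameter `Λup ≥ 4H_{⌊L/2⌋}` with `Λup·s ≥ 2` and
`ε(L,d)·K ≤ m(Λup)` (`K = Kinf`, `m = liftMargin`, `ε(L,d) = 2ρmax(11.71 ln L + 5.9)/L² + 4C₀ρmax/L`), `DualCert L (¾ε₁) z (z + d)`. [folklore] -/
theorem dualCert_threeQuarter_near_of_gap (hL : 8 ≤ L) (z : Tor L) (d : ℤ × ℤ) (hd : 2 ≤ |d.1| + |d.2|)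
    (hA : IsUnit (skelA d).det) (hs : 0 < TwoChannel.svec2 (skelA d)) (g : ℝ) (hg : 0 < g)
    (hgap : ∀ w : Fin 4 ⊕ Fin 4 → ℝ, ∑ i, w i = 0 →
      g * dotProduct w w ≤ dotProduct w ((twoHolePinf (skelA d)).mulVec w))
    (Λup : ℝ) (hcap : 4 * (harmonic (L / 2) : ℝ) ≤ Λup) (hΛ2 : 2 ≤ Λup * TwoChannel.svec2 (skelA d))
    (hthr : (2 * (rhoMax d * (11.71 * Real.log L + 5.9) / (L : ℝ) ^ 2)
          + 4 * (((15 / 2 * (Real.pi ^ 2 / 2 + Real.pi ^ 4 / 4) + 3 * Real.pi ^ 2 / 16)) * rhoMax d) / L)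
        * Kinf (skelA d) ≤ liftMargin g (TwoChannel.svec2 (skelA d)) (xBsq (skelA d)) Λup) :
    DualCert L (3 / 4 * eps1 L) z (z + castPt L d) := by
  have hε := (errCoeff_pos L hL d).le
  refine dualCert_threeQuarter_near L hL z d Λup hA hcap (by linarith) fun w => ?_
  have h1 := l1_smInv_le (skelA d) Λup hs hΛ2 w
  have h0 : 0 ≤ ∑ p, |(smInv (skelA d) Λup).mulVec (pad w) p| := Finset.sum_nonneg fun p _ => abs_nonneg _
  have h2 : (∑ p, |(smInv (skelA d) Λup).mulVec (pad w) p|) ^ 2 ≤ Kinf (skelA d) * dotProduct w w :=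
    (pow_le_pow_left₀ h0 h1 2).trans (Ninf_sq_le (skelA d) hs w)
  have h3 := twoHoleP_quad_ge_liftMargin d hd hA hs g hg hgap Λup (by linarith) w
  have hww : 0 ≤ dotProduct w w := by
    simp only [dotProduct]; exact Finset.sum_nonneg fun i _ => mul_self_nonneg _
  calc _ ≤ (2 * (rhoMax d * (11.71 * Real.log L + 5.9) / (L : ℝ) ^ 2)
          + 4 * (((15 / 2 * (Real.pi ^ 2 / 2 + Real.pi ^ 4 / 4) + 3 * Real.pi ^ 2 / 16)) * rhoMax d) / L)
          * (Kinf (skelA d) * dotProduct w w) := mul_le_mul_of_nonneg_left h2 hε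
    _ = ((2 * (rhoMax d * (11.71 * Real.log L + 5.9) / (L : ℝ) ^ 2)
          + 4 * (((15 / 2 * (Real.pi ^ 2 / 2 + Real.pi ^ 4 / 4) + 3 * Real.pi ^ 2 / 16)) * rhoMax d) / L)
          * Kinf (skelA d)) * dotProduct w w := by ring
    _ ≤ liftMargin g (TwoChannel.svec2 (skelA d)) (xBsq (skelA d)) Λup * dotProduct w w :=
        mul_le_mul_of_nonneg_right hthr hww
    _ ≤ _ := h3


end TwoHoleBS

end Summit.HubbardSuperconductivity.HubbardSuperconductivity.Theorems.AnisotropyChord.Transfer.Fibre3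

end
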